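import Literature.AlgebraicGeometry.AbelianSchemes.LevelBasisCoverTorsor
import Literature.AlgebraicGeometry.RelativeSpec.GeometricQuotientOfEtaleCover
import Literature.AlgebraicGeometry.AbelianSchemes.AbelianSchemeOverHomNoetherianAnyBase
import Literature.AlgebraicGeometry.Morphisms.FiniteEtaleSurjectiveLift
import HarnessLib

/-!
# The level-`M`-basis cover presents the base of an abelian scheme as a FREE `GL_{2g}(ℤ/M)`-quotient

Layer `Literature/AlgebraicGeometry/AbelianSchemes`, namespace `Literature.AlgebraicGeometry.AbelianSchemes.AbelianSchemeOver`.
THEOREMS ONLY (no `def`, no instance, no notation, no `sorry`).  Cell `hodgecm-mathlib` (D-0151), F-3 (M) carrier package (Ma0),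
FILE B3 = THE HEAD: the letter (Ma0) `stub_F3Ma0` of the (M) child line `Cruxes/HDel/Lines/F3DualAbelianSchemeM` (B-typ04 (g15) /
B-plan1 (g19), child ed. 4) in the free-base-quotient carrier OF RECORD of ★ `DualPairBaseQuotientDescent`
(`(ρ : ActionOver p G) (hq : ρ.IsGeometricQuotient p) [IsAffineHom p] (hfree : …)`).  HC_CM is proved only modulo the 7 printed
citations until rung 0 closes; nothing here is about HC.

## Source
[MumfordFogartyKirwan1994] Ch. 7 §2 Prop. 7.3, proof, step (IV) (pp. 133–134) and §3 Lemma 7.11 (p. 140): the scheme of level-`n`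
structures of an abelian scheme is finite étale over the base and a principal homogeneous space under `GL(2g, ℤ/n)`; [SGA1] Exp. V
Prop. 2.6 / Déf. 2.7 (a Galois cover is the quotient of its total space by the group); [GortzWedhorn2023] Prop. 27.188 (1).

## What is proved
* **`exists_levelBasisCover_free_geometricQuotient`** — for `A/S` of relative dimension `g` with commutative group law and `M ≠ 0`
  invertible on `S`: a finite étale surjective `b : B → S`, an action `ρ` of `GL (Fin g ⊕ Fin g) (ℤ/M)` on `B` over `S` with
  `ρ.IsGeometricQuotient b` (★ `isGeometricQuotient_of_etale_of_transitive` on the transitivity clause of ★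
  `exists_levelBasisCover_rebase`) and FREE on the affine charts (`free_of_forall_comp_aut_ne'` (★ `FreeActionOfPoints`, any universe) on its trivial-stabiliser clause),
  and a level-`M` structure on `A ×_S B`;
* **`exists_levelBasisCover_free_geometricQuotient_of_algebra_rat`** — the letter (Ma0) token for token: over `Spec R`, `R` a
  Noetherian `ℚ`-algebra (so `M` is invertible in every residue field and the group law is commutative, ★
  `isCommMonObj_of_isLocallyNoetherian_base`), with `B` affine;
* **`exists_connected_levelCover_free_geometricQuotient`** (`_of_algebra_rat`) — over a CONNECTED base, a CONNECTED cover: one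
  connected component of the torsor with the STABILISER subgroup (the shape the (Ma) assembly consumes: connected `S′`, abstract
  finite `G`).

## References
* [MumfordFogartyKirwan1994] D. Mumford, J. Fogarty, F. Kirwan, *Geometric Invariant Theory*, 3rd ed. (1994), Ch. 7 §2 Prop. 7.3,
  proof, step (IV) (pp. 133–134); §3 Lemma 7.11 (p. 140).
* [SGA1] A. Grothendieck, *SGA 1*, Exp. V, Prop. 2.6, Déf. 2.7.
* [GortzWedhorn2023] U. Görtz, T. Wedhorn, *Algebraic Geometry II* (2023), Prop. 27.188 (1) (p. 675).
-/

noncomputable section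

universe u

open CategoryTheory CategoryTheory.Limits AlgebraicGeometry MonoidalCategory CartesianMonoidalCategory Matrix

open scoped MonObj

namespace Literature.AlgebraicGeometry.RelativeSpec.ActionOver

/-! ### §0 Trivial stabilisers on geometric points ⇒ freeness on the affine charts (★ `FreeActionOfPoints` binds `G : Type u`; private copies for a group in ANY universe — here `GL (Fin g ⊕ Fin g) (ZMod M) : Type` and its subgroups act on `Scheme.{u}`) -/

variable {X Y : Scheme.{u}} {r : X ⟶ Y} {G : Type*} [Group G] (ρ : ActionOver r G)

set_option backward.isDefEq.respectTransparency false in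
/-- **Trivial inertia on geometric points ⇒ the `g·b − b` generate the unit ideal** on an affine chart `r⁻¹U` (★
`span_act_sub_eq_top_of_forall_ne` for a group `G` in any universe): otherwise a maximal ideal `𝔪 ⊇ (g·b − b)_b` of
`Γ(X, r⁻¹U)` gives the geometric point `Spec (Γ/𝔪)^alg → r⁻¹U ⊆ X` fixed by `g⁻¹`. [cite: SGA1, Exp. V Prop. 2.6 (i)] -/
private theorem span_act_sub_eq_top_of_forall_ne' (U : Y.Opens) (hU : IsAffineOpen (r ⁻¹ᵁ U)) (g : G)
    (hpt : ∀ (Ω : Type u) [Field Ω] [IsAlgClosed Ω] (x : Spec (.of Ω) ⟶ X),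
      x ≫ (ρ.aut g⁻¹).hom ≠ x) :
    Ideal.span (Set.range fun b : Γ(X, r ⁻¹ᵁ U) ↦ ρ.act g U b - b) = ⊤ := by
  by_contra hne
  obtain ⟨M, hM, hle⟩ := Ideal.exists_le_maximal _ hne
  letI : Field (Γ(X, r ⁻¹ᵁ U) ⧸ M) := Ideal.Quotient.field M
  let Ω : Type u := AlgebraicClosure (Γ(X, r ⁻¹ᵁ U) ⧸ M)
  let ψ : Γ(X, r ⁻¹ᵁ U) →+* Ω :=
    (algebraMap (Γ(X, r ⁻¹ᵁ U) ⧸ M) Ω).comp (Ideal.Quotient.mk M)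
  have hψ : ψ.comp (ρ.act g U) = ψ := by
    ext b
    change algebraMap _ Ω (Ideal.Quotient.mk M (ρ.act g U b)) = algebraMap _ Ω (Ideal.Quotient.mk M b)
    rw [Ideal.Quotient.eq.mpr (hle (Ideal.subset_span ⟨b, rfl⟩))]
  let x : Spec (.of Ω) ⟶ X := Spec.map (CommRingCat.ofHom ψ) ≫ hU.isoSpec.inv ≫ (r ⁻¹ᵁ U).ι
  refine hpt Ω x ?_
  have key : Spec.map (CommRingCat.ofHom ψ) ≫ Spec.map (CommRingCat.ofHom (ρ.act g U)) =
      Spec.map (CommRingCat.ofHom ψ) := by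
    rw [← Spec.map_comp, ← CommRingCat.ofHom_comp, hψ]
  change (Spec.map (CommRingCat.ofHom ψ) ≫ hU.isoSpec.inv ≫ (r ⁻¹ᵁ U).ι) ≫ (ρ.aut g⁻¹).hom =
    Spec.map (CommRingCat.ofHom ψ) ≫ hU.isoSpec.inv ≫ (r ⁻¹ᵁ U).ι
  rw [Category.assoc, Category.assoc, ← ρ.specMap_act_comp_ι g U hU, ← Category.assoc, key]

/-- **Trivial stabilisers on geometric points ⇒ free on the affine charts** (★ `free_of_forall_comp_aut_ne`, any universe):
if no `g ≠ 1` fixes an algebraically-closed-field-valued point of `X`, then on every affine `U ⊆ Y` (`r` affine) the `g·b − b`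
generate the unit ideal of `Γ(X, r⁻¹U)` — the `hfree` clause of ★ `DualPairBaseQuotientDescent`. [cite: SGA1, Exp. V Prop. 2.6 (i), Déf. 2.7] -/
private theorem free_of_forall_comp_aut_ne' [IsAffineHom r]
    (hpt : ∀ (Ω : Type u) [Field Ω] [IsAlgClosed Ω] (x : Spec (.of Ω) ⟶ X) (g : G), g ≠ 1 →
      x ≫ (ρ.aut g).hom ≠ x) :
    ∀ (U : Y.Opens), IsAffineOpen U → ∀ g : G, g ≠ 1 →
      Ideal.span (Set.range fun b : Γ(X, r ⁻¹ᵁ U) ↦ ρ.act g U b - b) = ⊤ :=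
  fun U hU g hg => ρ.span_act_sub_eq_top_of_forall_ne' U (hU.preimage r) g
    fun Ω _ _ x => hpt Ω x g⁻¹ (inv_ne_one.mpr hg)

end Literature.AlgebraicGeometry.RelativeSpec.ActionOver

namespace Literature.AlgebraicGeometry.AbelianSchemes

namespace AbelianSchemeOver

open Literature.AlgebraicGeometry.Morphisms Literature.AlgebraicGeometry.RelativeSpec

variable {S : Scheme.{u}} (A : AbelianSchemeOver S)

/-- **THE BASE OF AN ABELIAN SCHEME IS A FREE `GL_{2g}(ℤ/M)`-QUOTIENT OF ITS LEVEL-`M`-BASIS COVER** ([MumfordFogartyKirwan1994]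
Prop. 7.3 step (IV) / Lemma 7.11; [SGA1] V 2.6–2.7).  For `A/S` of relative dimension `g` with commutative group law and `M ≠ 0`
invertible in the residue fields of `S`: a finite étale surjective `b : B → S`, an action `ρ` of `GL (Fin g ⊕ Fin g) (ℤ/M)` on `B` over
`S` such that `b` IS A GEOMETRIC QUOTIENT (★ `ActionOver.isGeometricQuotient_of_etale_of_transitive`: the geometric fibres are `GL`-orbits)
and the action is FREE on the affine charts (`g·s − s` generate the unit ideal for `g ≠ 1`, `free_of_forall_comp_aut_ne'` (★ `FreeActionOfPoints`, any universe): stabilisers of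
field-valued points are trivial), and a level-`M` structure on `A ×_S B` (all three from ★ `exists_levelBasisCover_rebase`).
[cite: MumfordFogartyKirwan1994, Ch. 7 §2 Proposition 7.3, proof, step (IV) (pp. 133–134)]
[cite: MumfordFogartyKirwan1994, Ch. 7 §3 Lemma 7.11 (p. 140)] [cite: SGA1, Exp. V Prop. 2.6, Déf. 2.7] -/
theorem exists_levelBasisCover_free_geometricQuotient [IsCommMonObj A.X] {g M : ℕ} [NeZero M] (hg : A.IsOfRelDim g)
    (hM : ∀ s : S, (M : S.residueField s) ≠ 0) :
    ∃ (B : Scheme.{u}) (b : B ⟶ S) (_ : IsFinite b) (_ : Etale b) (_ : Surjective b)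
      (ρ : ActionOver b (Matrix.GeneralLinearGroup (Fin g ⊕ Fin g) (ZMod M))),
      ρ.IsGeometricQuotient b ∧
      (∀ (V : S.Opens), IsAffineOpen V → ∀ γ₀ : Matrix.GeneralLinearGroup (Fin g ⊕ Fin g) (ZMod M), γ₀ ≠ 1 →
        Ideal.span (Set.range fun s : Γ(B, b ⁻¹ᵁ V) ↦ ρ.act γ₀ V s - s) = ⊤) ∧
      Nonempty (LevelStructure g M (A.baseChange b)) := by
  obtain ⟨B, b, hfin, het, hsurj, ρ, hlev, -, hstab, htrans⟩ := A.exists_levelBasisCover_rebase hg hM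
  haveI := hfin
  haveI := het
  haveI := hsurj
  refine ⟨B, b, hfin, het, hsurj, ρ, ρ.isGeometricQuotient_of_etale_of_transitive htrans,
    ρ.free_of_forall_comp_aut_ne' fun Ω _ _ x γ₀ hγ₀ hx => hγ₀ (hstab Ω x γ₀ hx), hlev⟩

/-- A natural number `m ≠ 0` is nonzero in every residue field of the spectrum of a `ℚ`-algebra (the structure map
`ℚ → κ(s)` is a ring map out of a field of characteristic zero). [folklore] -/
private theorem natCast_residueField_spec_ne_zero (R : Type) [CommRing R] [Algebra ℚ R] (m : ℕ) [NeZero m]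
    (s : ↥(Spec (.of R))) : (m : (Spec (.of R)).residueField s) ≠ 0 := by
  let φ : ℚ →+* (Spec (.of R)).residueField s :=
    (Spec.preimage ((Spec (.of R)).fromSpecResidueField s ≫
      Spec.map (CommRingCat.ofHom (algebraMap ℚ R)))).hom
  rw [← map_natCast φ m]
  exact (map_ne_zero φ).mpr (Nat.cast_ne_zero.mpr (NeZero.ne m))

/-- **Letter (Ma0) of the F-3 (M) child line, token for token** ([MumfordFogartyKirwan1994] Prop. 7.3 step (IV) / Lemma 7.11 in the
free-base-quotient carrier of ★ `DualPairBaseQuotientDescent`): for an abelian scheme `A → Spec R` of relative dimension `g` over a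
Noetherian `ℚ`-algebra `R` and `m ≥ 1`, the level-`m`-basis cover is a finite étale surjective `p : S′ → Spec R` with `S′` affine,
carrying an action of `GL_{2g}(ℤ/m)` of which `Spec R` is the geometric quotient and which is free on the affine charts, and `A ×_R S′`
has a level-`m` structure.  The group law is commutative by ★ `isCommMonObj_of_isLocallyNoetherian_base`; `m` is invertible on
`Spec R` because `R` is a `ℚ`-algebra; `S′` is affine as a finite cover of an affine scheme (Mathlib `isAffine_of_isAffineHom`).
(Universe `0`, as the letter: `ℚ : Type`; the universe-polymorphic content is `exists_levelBasisCover_free_geometricQuotient`.)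
[cite: MumfordFogartyKirwan1994, Ch. 7 §2 Proposition 7.3, proof, step (IV) (pp. 133–134)]
[cite: MumfordFogartyKirwan1994, Ch. 7 §3 Lemma 7.11 (p. 140)] [cite: GortzWedhorn2023, Prop. 27.188 (1) (p. 675)]
[cite: SGA1, Exp. V Prop. 2.6, Déf. 2.7] -/
theorem exists_levelBasisCover_free_geometricQuotient_of_algebra_rat (R : Type) [CommRing R] [IsNoetherianRing R]
    [Algebra ℚ R] (A : AbelianSchemeOver (Spec (.of R))) {g : ℕ} (hg : A.IsOfRelDim g) (m : ℕ) [NeZero m] :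
    ∃ (S' : Scheme.{0}) (p : S' ⟶ Spec (.of R)) (_ : IsAffine S') (_ : IsAffineHom p) (_ : IsFinite p) (_ : Etale p)
      (_ : Surjective p) (ρ : ActionOver p (Matrix.GeneralLinearGroup (Fin g ⊕ Fin g) (ZMod m))),
      ρ.IsGeometricQuotient p ∧
      (∀ (V : (Spec (.of R)).Opens), IsAffineOpen V → ∀ γ₀ : Matrix.GeneralLinearGroup (Fin g ⊕ Fin g) (ZMod m), γ₀ ≠ 1 →
        Ideal.span (Set.range fun s : Γ(S', p ⁻¹ᵁ V) ↦ ρ.act γ₀ V s - s) = ⊤) ∧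
      Nonempty (AbelianSchemeOver.LevelStructure g m (A.baseChange p)) := by
  haveI : IsCommMonObj A.X := A.isCommMonObj_of_isLocallyNoetherian_base
  obtain ⟨B, b, hfin, het, hsurj, ρ, hq, hfree, hlev⟩ :=
    A.exists_levelBasisCover_free_geometricQuotient hg (natCast_residueField_spec_ne_zero R m)
  haveI := hfin
  haveI : IsAffine B := isAffine_of_isAffineHom b
  exact ⟨B, b, inferInstance, inferInstance, hfin, het, hsurj, ρ, hq, hfree, hlev⟩

/-! ### §3 Over a CONNECTED base: a CONNECTED cover, quotient by the stabiliser of a component -/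

set_option backward.isDefEq.respectTransparency false in
/-- **A CONNECTED free-quotient presentation over a connected base** ([MumfordFogartyKirwan1994] Prop. 7.3 step (IV) / Lemma 7.11
with [SGA1] V 2.6–2.7 applied to ONE connected component of the Galois cover): for `A/S` of relative dimension `g` with commutative
group law over a CONNECTED locally Noetherian `S` and `M ≠ 0` invertible on `S`, there are a CONNECTED `C`, a finite étale surjective
`c : C → S` (the connected component of a point of the level-`M`-basis cover `B`, ★
`exists_clopen_connected_component_surjective_of_mem_of_isLocallyNoetherian`), a FINITE group `H` (the stabiliser of the component in
`GL (Fin g ⊕ Fin g) (ℤ/M)`) acting on `C` over `S` FREELY with `c` a GEOMETRIC QUOTIENT, and a level-`M` structure on `A ×_S C`.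
Pointwise: stabilisers in `H` are trivial because they are in `GL` (★ `exists_levelBasisCover_rebase`); `H` is transitive on
geometric fibres of `C` because the `γ ∈ GL` carrying `x̄₁ ↦ x̄₂` maps the component of `x̄₁` onto the component of `x̄₂` (Mathlib
`Continuous.image_connectedComponent_subset`, both ways), i.e. stabilises `C`; then ★ `isGeometricQuotient_of_etale_of_transitive`
and `free_of_forall_comp_aut_ne'` (★ `FreeActionOfPoints`, any universe). [cite: MumfordFogartyKirwan1994, Ch. 7 §3 Lemma 7.11 (p. 140)]
[cite: SGA1, Exp. V Prop. 2.6, Déf. 2.7] [cite: GortzWedhorn2023, Prop. 27.188 (1) (p. 675)] -/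
theorem exists_connected_levelCover_free_geometricQuotient [IsCommMonObj A.X] [IsLocallyNoetherian S] [ConnectedSpace S]
    {g M : ℕ} [NeZero M] (hg : A.IsOfRelDim g) (hM : ∀ s : S, (M : S.residueField s) ≠ 0) :
    ∃ (C : Scheme.{u}) (c : C ⟶ S) (_ : ConnectedSpace C) (_ : IsFinite c) (_ : Etale c) (_ : Surjective c)
      (H : Type) (_ : Group H) (_ : Fintype H) (ρ : ActionOver c H),
      ρ.IsGeometricQuotient c ∧
      (∀ (V : S.Opens), IsAffineOpen V → ∀ h : H, h ≠ 1 →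
        Ideal.span (Set.range fun s : Γ(C, c ⁻¹ᵁ V) ↦ ρ.act h V s - s) = ⊤) ∧
      Nonempty (LevelStructure g M (A.baseChange c)) := by
  classical
  obtain ⟨B, b, hfin, het, hsurj, ρ, -, hlev, hstab, htrans⟩ := A.exists_levelBasisCover_rebase hg hM
  haveI := hfin
  haveI := het
  haveI := hsurj
  -- a point of `B` and its connected component `U` (clopen, connected, finite étale surjective over `S`)
  obtain ⟨s₀⟩ := (inferInstance : Nonempty S)
  obtain ⟨x₀, -⟩ := hsurj.surj s₀
  obtain ⟨U, hx₀, hUc, hUconn, hUfin, hUet, hUsurj⟩ :=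
    exists_clopen_connected_component_surjective_of_mem_of_isLocallyNoetherian b x₀
  haveI := hUfin
  haveI := hUet
  haveI := hUsurj
  have hUeq : (U : Set B) = connectedComponent x₀ :=
    Set.Subset.antisymm
      ((isPreconnected_iff_preconnectedSpace.mpr
        (inferInstance : PreconnectedSpace (U : Scheme.{u}))).subset_connectedComponent hx₀)
      (IsClopen.connectedComponent_subset ⟨hUc, U.2⟩ hx₀)
  -- `γ⁻¹` undoes `γ` on points
  have hinv : ∀ (γ₀ : Matrix.GeneralLinearGroup (Fin g ⊕ Fin g) (ZMod M)) (z : B),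
      (ρ.aut γ₀⁻¹).hom ((ρ.aut γ₀).hom z) = z := fun γ₀ z => by
    rw [← Scheme.Hom.comp_apply, map_inv, Aut.Aut_inv_def, Iso.symm_hom, Iso.hom_inv_id]
    rfl
  -- the stabiliser `H` of `U`
  let H : Subgroup (Matrix.GeneralLinearGroup (Fin g ⊕ Fin g) (ZMod M)) :=
    { carrier := {γ₀ | ∀ z : B, (ρ.aut γ₀).hom z ∈ (U : Set B) ↔ z ∈ (U : Set B)}
      mul_mem' := fun {γ₀ γ₁} h₀ h₁ z => by
        rw [map_mul, Aut.Aut_mul_def, Iso.trans_hom, Scheme.Hom.comp_apply]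
        exact (h₀ ((ρ.aut γ₁).hom z)).trans (h₁ z)
      one_mem' := fun z => by rw [map_one]; rfl
      inv_mem' := fun {γ₀} h₀ z => by
        have h1 := hinv γ₀⁻¹ z
        rw [inv_inv] at h1
        have h2 := h₀ ((ρ.aut γ₀⁻¹).hom z)
        rw [h1] at h2
        exact h2.symm }
  have hHU : ∀ h : H, (ρ.aut (h : Matrix.GeneralLinearGroup (Fin g ⊕ Fin g) (ZMod M))).hom ⁻¹ᵁ U = U := fun h =>
    TopologicalSpace.Opens.ext (Set.ext fun z => h.2 z)
  -- membership in `H` from ONE point: `γ` maps the component of `z` onto the component of `γ z`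
  have hmemH : ∀ (γ₀ : Matrix.GeneralLinearGroup (Fin g ⊕ Fin g) (ZMod M)) (z : B), z ∈ (U : Set B) →
      (ρ.aut γ₀).hom z ∈ (U : Set B) → γ₀ ∈ H := by
    intro γ₀ z hz hγz y
    have himg : ∀ (δ : Matrix.GeneralLinearGroup (Fin g ⊕ Fin g) (ZMod M)) (y₁ : B), y₁ ∈ (U : Set B) →
        (ρ.aut δ).hom y₁ ∈ (U : Set B) → ∀ y : B, y ∈ (U : Set B) → (ρ.aut δ).hom y ∈ (U : Set B) := by
      intro δ y₁ hy₁ hδy₁ y hy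
      rw [hUeq] at hy₁ hδy₁ hy ⊢
      have hsub := (ρ.aut δ).hom.continuous.image_connectedComponent_subset y₁
      rw [← connectedComponent_eq hy₁, ← connectedComponent_eq hδy₁] at hsub
      exact hsub ⟨y, hy, rfl⟩
    refine ⟨fun hy => ?_, himg γ₀ z hz hγz y⟩
    have hz' : (ρ.aut γ₀⁻¹).hom ((ρ.aut γ₀).hom z) ∈ (U : Set B) := by rw [hinv]; exact hz
    have := himg γ₀⁻¹ _ hγz hz' _ hy
    rwa [hinv] at this
  -- the action of `H` on `B` and its restriction to the `H`-stable clopen `U`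
  let ρH : ActionOver b H := ⟨ρ.aut.comp H.subtype, fun h => ρ.aut_comp h⟩
  obtain ⟨ρU, hρι⟩ : ∃ ρU : ActionOver (U.ι ≫ b) H,
      ∀ h : H, (ρU.aut h).hom ≫ U.ι = U.ι ≫ (ρ.aut (h : Matrix.GeneralLinearGroup _ (ZMod M))).hom :=
    ⟨ρH.restrict U hHU, fun h => ρH.restrictHom_ι U hHU h⟩
  haveI : Fintype H := Fintype.ofFinite H
  -- pointwise clauses for `H` on `U`
  have hstabU : ∀ (Ω : Type u) [Field Ω] [IsAlgClosed Ω] (x : Spec (.of Ω) ⟶ (U : Scheme.{u})) (h : H), h ≠ 1 →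
      x ≫ (ρU.aut h).hom ≠ x := by
    intro Ω _ _ x h hh hx
    apply hh
    have hx' : (x ≫ U.ι) ≫ (ρ.aut (h : Matrix.GeneralLinearGroup _ (ZMod M))).hom = x ≫ U.ι := by
      rw [Category.assoc, ← hρι, ← Category.assoc, hx]
    exact Subtype.ext (hstab Ω (x ≫ U.ι) h hx')
  have htransU : ∀ (Ω : Type u) [Field Ω] [IsAlgClosed Ω] (x₁ x₂ : Spec (.of Ω) ⟶ (U : Scheme.{u})),
      x₁ ≫ U.ι ≫ b = x₂ ≫ U.ι ≫ b → ∃ h : H, x₂ = x₁ ≫ (ρU.aut h).hom := by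
    intro Ω _ _ x₁ x₂ h12
    obtain ⟨γ₀, hγ₀⟩ := htrans Ω (x₁ ≫ U.ι) (x₂ ≫ U.ι) (by simpa only [Category.assoc] using h12)
    have hmem : γ₀ ∈ H := by
      refine hmemH γ₀ ((x₁ ≫ U.ι) (IsLocalRing.closedPoint Ω)) ?_ ?_
      · rw [Scheme.Hom.comp_apply]; exact (x₁ _).2
      · rw [← Scheme.Hom.comp_apply, ← hγ₀, Scheme.Hom.comp_apply]; exact (x₂ _).2
    refine ⟨⟨γ₀, hmem⟩, (cancel_mono U.ι).1 ?_⟩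
    rw [hγ₀, Category.assoc, Category.assoc, hρι ⟨γ₀, hmem⟩]
  refine ⟨U, U.ι ≫ b, hUconn, hUfin, hUet, hUsurj, H, inferInstance, inferInstance, ρU,
    ρU.isGeometricQuotient_of_etale_of_transitive htransU, ρU.free_of_forall_comp_aut_ne' hstabU, hlev _ U.ι⟩

/-- **Letter shape for the (Ma) assembly over a CONNECTED Noetherian affine `ℚ`-base** (the (M) child line's `stub_F3Ma` ed. 4
∃-prefix, minus the `ρA`/`K′` clauses): a CONNECTED affine finite étale surjective cover `p : S′ → Spec R`, a finite group `G`
acting freely with `Spec R` the geometric quotient, and a level-`m` structure on `A ×_R S′` (★ `exists_connected_levelCover_free_geometricQuotient`;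
commutativity ★ `isCommMonObj_of_isLocallyNoetherian_base`, `m` invertible since `R` is a `ℚ`-algebra, `S′` affine over the affine base).
[cite: MumfordFogartyKirwan1994, Ch. 7 §3 Lemma 7.11 (p. 140)] [cite: SGA1, Exp. V Prop. 2.6, Déf. 2.7] -/
theorem exists_connected_levelCover_free_geometricQuotient_of_algebra_rat (R : Type) [CommRing R] [IsNoetherianRing R]
    [Algebra ℚ R] [ConnectedSpace ↥(Spec (.of R))] (A : AbelianSchemeOver (Spec (.of R))) {g : ℕ} (hg : A.IsOfRelDim g)
    (m : ℕ) [NeZero m] :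
    ∃ (S' : Scheme.{0}) (p : S' ⟶ Spec (.of R)) (_ : IsAffine S') (_ : ConnectedSpace S') (_ : IsAffineHom p) (_ : IsFinite p)
      (_ : Etale p) (_ : Surjective p) (G : Type) (_ : Group G) (_ : Fintype G) (ρ : ActionOver p G),
      ρ.IsGeometricQuotient p ∧
      (∀ (V : (Spec (.of R)).Opens), IsAffineOpen V → ∀ γ₀ : G, γ₀ ≠ 1 →
        Ideal.span (Set.range fun s : Γ(S', p ⁻¹ᵁ V) ↦ ρ.act γ₀ V s - s) = ⊤) ∧
      Nonempty (AbelianSchemeOver.LevelStructure g m (A.baseChange p)) := by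
  haveI : IsCommMonObj A.X := A.isCommMonObj_of_isLocallyNoetherian_base
  obtain ⟨C, c, hconn, hfin, het, hsurj, H, iH, fH, ρ, hq, hfree, hlev⟩ :=
    A.exists_connected_levelCover_free_geometricQuotient hg (natCast_residueField_spec_ne_zero R m)
  haveI := hfin
  haveI : IsAffine C := isAffine_of_isAffineHom c
  exact ⟨C, c, inferInstance, hconn, inferInstance, hfin, het, hsurj, H, iH, fH, ρ, hq, hfree, hlev⟩

end AbelianSchemeOver

end Literature.AlgebraicGeometry.AbelianSchemes

end
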